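import Mathlib
import HarnessLib
import Summits.HubbardSuperconductivity.HubbardSuperconductivity.Theorems.KLProgrammeKLRegimeTwoVolumeDualMomentumReadout
import Summits.HubbardSuperconductivity.HubbardSuperconductivity.Theorems.KLProgrammeKLRegimeVolumeLimitFlowFramesV17F2

/-!
# Route `KLProgramme` — crux K3, VL child `KLRegimeVolumeLimitV17F2` (stmt-HubbardSuperconductivity-20440): THE REGISTERED STUB TEXT FROM THE
# LAST-SCALE PINNED ROW DEFECT IN DUAL-LATTICE CURRENCY (the leanest target for ROUTE A's (A3))
# (cell gate-hubbard-kl, seat hubbard-kl-k3c5-p3 g9, technique «OS-positivity-free direct assembly»)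

Sequel of `…TwoVolumeDualMomentumReadout` (§3: `‖Σ^{K_L}_L(ω,k) − Σ^{K_{L″}}_{L″}(ω,k″)‖ ≤ |K_L(p) − K_{L″}(p)| + 2ε·(Ddef₊ + Dfar₊)`, rows of the
position-space two-leg kernels of `G_V = 𝒱_V⁽ⁿ⁾[K_V] − 𝒩_{K_V}`, ANY pins) and of the tower's frame comparability [tree] `flowFrames_twoVolume_of_towerV17F2`
(`|K_L(p) − K_{L″}(p)| ≤ (Σ_{m ≤ n_β} Q.CL β m)/L`).  Compared with `…LastScaleDefectDoor` (grid currency) and `…LastScaleResummedDoor` (field currency) the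
hypothesis here carries NO unit partition function, NO resummation and NO symbol term:

* **`framedNestedFlowTextV17F2_of_lastScaleDualDefectText`**: IF, inside the regime binders and under the tower, for every Matsubara integer `n` there are
  `L₀` and `δ → 0` such that for `L ≥ L₀`, `L″ = b·L`, eventually in the common cutoff `M`, there are pins `o_c ∈ SpaceTimeIdx L M`, `o_f ∈ SpaceTimeIdx L″ M`
  with `2ε·(Ddef₊ + Dfar₊) ≤ δ L` at every label of integer `n` (σ = 0, last scale, own flow frames), THEN the stub text holds with rate
  `(Σ_{m ≤ n_β} Q.CL β m)/L + δ L`;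
* `volumeLimitTextV17F2_of_lastScaleDualDefectText` — hence the VL child text.

Proofs only; no definition.  References: BGM 2006 §2.4 (2.38), Lemmas 2.4–2.5.
-/

noncomputable section

namespace Summit.HubbardSuperconductivity.HubbardSuperconductivity.Theorems.TwoPointAssembly

set_option linter.dupNamespace false -- summit = problem name (single-conjunct summit), D-0017

open Finset Filter Topology Complex Literature.MathematicalPhysics.QuantumLattice Literature.Probability.LatticeModels GrassmannAlgebra
open Summit.HubbardSuperconductivity.HubbardSuperconductivity.Theorems.KLRegimeSplit
open Summit.HubbardSuperconductivity.HubbardSuperconductivity.Theorems.KLProgrammeLegKernels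
open Summit.HubbardSuperconductivity.HubbardSuperconductivity.Theorems.TwoVolumeDefect

/-- **THE STUB TEXT OF «cauchy v8-F2» FROM THE LAST-SCALE PINNED ROW DEFECT (dual currency).**  See the module docstring; `ε = imagTimeWeight β M`,
`G_V = klEffectiveAction V M β U μ (klFlowFrameU V M β U μ (n_β+1)) klE0 (n_β+1) − counterQuadratic V M β (klFlowFrameU V M β U μ (n_β+1))`, rows
`R_V(o;y) = Σ_{t₁} W_{G_V}(o,(t₁,o⃗+y))·e^{iω(t_o−t₁)}`, `W = sectorisedKernel β (trivialMultiplier) · 2 ((0,0,+),(0,0,−))`, `ȳ↑ = proj (cRep ȳ)`.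
[cite: BenfattoGiulianiMastropietro2006, §2.4 (2.38)] -/
theorem framedNestedFlowTextV17F2_of_lastScaleDualDefectText
    (hD : ∀ (G : GeoConsts) (P : SplitConsts) (Q : EngConsts) (R : RenConsts), G.WF → P.WF → Q.WF → R.WF →
      ∃ c₅ : ℝ, 0 < c₅ ∧ ∀ c : ℝ, 0 < c → c ≤ c₅ → ∃ U₀ : ℝ, 0 < U₀ ∧
        ∀ μ ∈ klWindowC, ∀ U : ℝ, 0 < U → U ≤ U₀ → ∀ β : ℝ, klBetaMin ≤ β → β ≤ Real.exp (c / U ^ 2) →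
          ∀ K : TrigPolyC4v, klPredsV17F2.frameOK R U (nScales β) μ K →
            ∀ (Lstar : ℕ) (Mstar : ℕ → ℕ), TowerP klPredsV17F2 G P Q R β U μ K Lstar Mstar →
              ∀ n : ℤ, ∃ L₀ : ℕ, ∃ δ : ℕ → ℝ, Tendsto δ atTop (𝓝 0) ∧
                ∀ (L : ℕ) [NeZero L], L₀ ≤ L → ∀ (L'' : ℕ) [NeZero L''] (b : ℕ), L'' = b * L → ∃ M₀ : ℕ, ∀ (M : ℕ) [NeZero M], M₀ ≤ M →
                  ∃ (oc : SpaceTimeIdx L M) (of : SpaceTimeIdx L'' M), ∀ ω : MatsubaraIdx M, matsubaraInt M ω = n →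
                    2 * imagTimeWeight β M *
                      ((∑ ybar : TorusSite 2 L,
                          ‖(∑ t₁ : ImagTimeIdx M,
                              sectorisedKernel L M β (trivialMultiplier L M)
                                  (klEffectiveAction L M β U μ (klFlowFrameU L M β U μ (nScales β + 1)) klE0 (nScales β + 1) -
                                    counterQuadratic L M β (klFlowFrameU L M β U μ (nScales β + 1))) 2
                                  (![((0, 0), 0), ((0, 0), 1)] : Fin 2 → SectorLeg 1) ![oc, (t₁, oc.2 + ybar)] *
                                Complex.exp (((matsubaraFreq β M ω * (imagTime β M oc.1 - imagTime β M t₁) : ℝ) : ℂ) * I)) -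
                            (∑ t₁ : ImagTimeIdx M,
                              sectorisedKernel L'' M β (trivialMultiplier L'' M)
                                  (klEffectiveAction L'' M β U μ (klFlowFrameU L'' M β U μ (nScales β + 1)) klE0 (nScales β + 1) -
                                    counterQuadratic L'' M β (klFlowFrameU L'' M β U μ (nScales β + 1))) 2
                                  (![((0, 0), 0), ((0, 0), 1)] : Fin 2 → SectorLeg 1) ![of, (t₁, of.2 + Torus.proj L'' (Torus.cRep ybar))] *
                                Complex.exp (((matsubaraFreq β M ω * (imagTime β M of.1 - imagTime β M t₁) : ℝ) : ℂ) * I))‖) +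
                        ∑ y ∈ univ.filter (fun y : TorusSite 2 L'' => Torus.proj L'' (Torus.cRep (fun i => (((y i).val : ℕ) : ZMod L))) ≠ y),
                          ‖∑ t₁ : ImagTimeIdx M,
                              sectorisedKernel L'' M β (trivialMultiplier L'' M)
                                  (klEffectiveAction L'' M β U μ (klFlowFrameU L'' M β U μ (nScales β + 1)) klE0 (nScales β + 1) -
                                    counterQuadratic L'' M β (klFlowFrameU L'' M β U μ (nScales β + 1))) 2
                                  (![((0, 0), 0), ((0, 0), 1)] : Fin 2 → SectorLeg 1) ![of, (t₁, of.2 + y)] *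
                                Complex.exp (((matsubaraFreq β M ω * (imagTime β M of.1 - imagTime β M t₁) : ℝ) : ℂ) * I)‖) ≤ δ L) :
    ∀ (G : GeoConsts) (P : SplitConsts) (Q : EngConsts) (R : RenConsts), G.WF → P.WF → Q.WF → R.WF →
      ∃ c₅ : ℝ, 0 < c₅ ∧ ∀ c : ℝ, 0 < c → c ≤ c₅ → ∃ U₀ : ℝ, 0 < U₀ ∧
        ∀ μ ∈ klWindowC, ∀ U : ℝ, 0 < U → U ≤ U₀ → ∀ β : ℝ, klBetaMin ≤ β → β ≤ Real.exp (c / U ^ 2) →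
          ∀ K : TrigPolyC4v, klPredsV17F2.frameOK R U (nScales β) μ K →
            ∀ (Lstar : ℕ) (Mstar : ℕ → ℕ), TowerP klPredsV17F2 G P Q R β U μ K Lstar Mstar →
              ∀ n : ℤ, ∃ L₀ : ℕ, ∃ ρ : ℕ → ℝ, Tendsto ρ atTop (𝓝 0) ∧
                ∀ (L : ℕ) [NeZero L], L₀ ≤ L → ∀ (L'' : ℕ) [NeZero L''], L ∣ L'' → ∃ M₀ : ℕ, ∀ (M : ℕ) [NeZero M], M₀ ≤ M →
                  ∀ (ω : MatsubaraIdx M), matsubaraInt M ω = n → ∀ (k : TorusSite 2 L) (k'' : TorusSite 2 L''),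
                    latticeMomentum L'' k'' = latticeMomentum L k →
                      ‖klSelfEnergy L M β U μ (klFlowFrameU L M β U μ (nScales β + 1)) klE0 (nScales β + 1) (ω, k) 0 -
                          klSelfEnergy L'' M β U μ (klFlowFrameU L'' M β U μ (nScales β + 1)) klE0 (nScales β + 1) (ω, k'') 0‖ ≤ ρ L := by
  intro G P Q R hG hP hQ hR
  obtain ⟨c₅, hc₅, hc⟩ := hD G P Q R hG hP hQ hR
  refine ⟨c₅, hc₅, fun c hc0 hcc => ?_⟩
  obtain ⟨U₀, hU₀, hU⟩ := hc c hc0 hcc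
  refine ⟨U₀, hU₀, fun μ hμ U hU0 hUU β hβmin hβmax K hK Lstar Mstar hT n => ?_⟩
  have hβ : 0 < β := pos_of_klBetaMin_le hβmin
  obtain ⟨L₀D, δ, hδ, hDn⟩ := hU μ hμ U hU0 hUU β hβmin hβmax K hK Lstar Mstar hT n
  refine ⟨max L₀D Lstar, fun L => (∑ m ∈ range (nScales β + 1), Q.CL β m) / L + δ L, ?_, fun L _ hL L'' _ hdvd => ?_⟩
  · simpa using (tendsto_const_div_atTop_nhds_zero_nat (∑ m ∈ range (nScales β + 1), Q.CL β m)).add hδ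
  obtain ⟨b, hb⟩ := hdvd
  have hb' : L'' = b * L := by rw [hb, mul_comm]
  have hL₀ : L₀D ≤ L := (le_max_left _ _).trans hL
  have hLs : Lstar ≤ L := (le_max_right _ _).trans hL
  have hLL'' : L ≤ L'' := Nat.le_of_dvd (Nat.pos_of_ne_zero (NeZero.ne L'')) ⟨b, hb⟩
  obtain ⟨M₀D, hM₀D⟩ := hDn L hL₀ L'' b hb'
  refine ⟨max M₀D (max (max (Mstar L) (Mstar L'')) (max (Q.M0 β L) (Q.M0 β L''))), fun M _ hM ω hω k k'' hk => ?_⟩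
  have hM₀ : M₀D ≤ M := (le_max_left _ _).trans hM
  have hM₁ : Mstar L ≤ M := (le_max_left _ _).trans ((le_max_left _ _).trans ((le_max_right _ _).trans hM))
  have hM₁'' : Mstar L'' ≤ M := (le_max_right _ _).trans ((le_max_left _ _).trans ((le_max_right _ _).trans hM))
  have hM₂ : Q.M0 β L ≤ M := (le_max_left _ _).trans ((le_max_right _ _).trans ((le_max_right _ _).trans hM))
  have hM₂'' : Q.M0 β L'' ≤ M := (le_max_right _ _).trans ((le_max_right _ _).trans ((le_max_right _ _).trans hM))
  obtain ⟨oc, of, hw⟩ := hM₀D M hM₀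
  have hDef := hw ω hω
  have hframe := flowFrames_twoVolume_of_towerV17F2 hμ hT hLs hLL'' hM₁ hM₂ hM₁'' hM₂'' le_rfl (latticeMomentum L k)
  exact (norm_klSelfEnergy_sub_le_frame_add_dualDefect hb' hβ U μ _ _ (nScales β + 1) ω 0 oc of hk).trans (add_le_add hframe hDef)

/-- **The VL child text from the last-scale pinned row defect (dual currency)** (∘ `volumeLimitTextV17F2_of_framedNestedFlowText`).
[cite: BenfattoGiulianiMastropietro2006, §2.4 (2.38)] -/
theorem volumeLimitTextV17F2_of_lastScaleDualDefectText
    (hD : ∀ (G : GeoConsts) (P : SplitConsts) (Q : EngConsts) (R : RenConsts), G.WF → P.WF → Q.WF → R.WF →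
      ∃ c₅ : ℝ, 0 < c₅ ∧ ∀ c : ℝ, 0 < c → c ≤ c₅ → ∃ U₀ : ℝ, 0 < U₀ ∧
        ∀ μ ∈ klWindowC, ∀ U : ℝ, 0 < U → U ≤ U₀ → ∀ β : ℝ, klBetaMin ≤ β → β ≤ Real.exp (c / U ^ 2) →
          ∀ K : TrigPolyC4v, klPredsV17F2.frameOK R U (nScales β) μ K →
            ∀ (Lstar : ℕ) (Mstar : ℕ → ℕ), TowerP klPredsV17F2 G P Q R β U μ K Lstar Mstar →
              ∀ n : ℤ, ∃ L₀ : ℕ, ∃ δ : ℕ → ℝ, Tendsto δ atTop (𝓝 0) ∧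
                ∀ (L : ℕ) [NeZero L], L₀ ≤ L → ∀ (L'' : ℕ) [NeZero L''] (b : ℕ), L'' = b * L → ∃ M₀ : ℕ, ∀ (M : ℕ) [NeZero M], M₀ ≤ M →
                  ∃ (oc : SpaceTimeIdx L M) (of : SpaceTimeIdx L'' M), ∀ ω : MatsubaraIdx M, matsubaraInt M ω = n →
                    2 * imagTimeWeight β M *
                      ((∑ ybar : TorusSite 2 L,
                          ‖(∑ t₁ : ImagTimeIdx M,
                              sectorisedKernel L M β (trivialMultiplier L M)
                                  (klEffectiveAction L M β U μ (klFlowFrameU L M β U μ (nScales β + 1)) klE0 (nScales β + 1) -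
                                    counterQuadratic L M β (klFlowFrameU L M β U μ (nScales β + 1))) 2
                                  (![((0, 0), 0), ((0, 0), 1)] : Fin 2 → SectorLeg 1) ![oc, (t₁, oc.2 + ybar)] *
                                Complex.exp (((matsubaraFreq β M ω * (imagTime β M oc.1 - imagTime β M t₁) : ℝ) : ℂ) * I)) -
                            (∑ t₁ : ImagTimeIdx M,
                              sectorisedKernel L'' M β (trivialMultiplier L'' M)
                                  (klEffectiveAction L'' M β U μ (klFlowFrameU L'' M β U μ (nScales β + 1)) klE0 (nScales β + 1) -
                                    counterQuadratic L'' M β (klFlowFrameU L'' M β U μ (nScales β + 1))) 2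
                                  (![((0, 0), 0), ((0, 0), 1)] : Fin 2 → SectorLeg 1) ![of, (t₁, of.2 + Torus.proj L'' (Torus.cRep ybar))] *
                                Complex.exp (((matsubaraFreq β M ω * (imagTime β M of.1 - imagTime β M t₁) : ℝ) : ℂ) * I))‖) +
                        ∑ y ∈ univ.filter (fun y : TorusSite 2 L'' => Torus.proj L'' (Torus.cRep (fun i => (((y i).val : ℕ) : ZMod L))) ≠ y),
                          ‖∑ t₁ : ImagTimeIdx M,
                              sectorisedKernel L'' M β (trivialMultiplier L'' M)
                                  (klEffectiveAction L'' M β U μ (klFlowFrameU L'' M β U μ (nScales β + 1)) klE0 (nScales β + 1) -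
                                    counterQuadratic L'' M β (klFlowFrameU L'' M β U μ (nScales β + 1))) 2
                                  (![((0, 0), 0), ((0, 0), 1)] : Fin 2 → SectorLeg 1) ![of, (t₁, of.2 + y)] *
                                Complex.exp (((matsubaraFreq β M ω * (imagTime β M of.1 - imagTime β M t₁) : ℝ) : ℂ) * I)‖) ≤ δ L) :
    VolumeLimitP2 klPredsV17F2 FinalTwoLegVolLimitEx klWindowC :=
  volumeLimitTextV17F2_of_framedNestedFlowText (framedNestedFlowTextV17F2_of_lastScaleDualDefectText hD)

end Summit.HubbardSuperconductivity.HubbardSuperconductivity.Theorems.TwoPointAssembly
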